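import Summits.QuantumFields.BalabanUV.T4Continuum.Support.ShellMeasureRootComposition
import Summits.QuantumFields.BalabanUV.T4Continuum.Support.ShellMeasureWindowLiaison

/-!
# `T4Continuum.ShellMeasureRootCompositionPush` — the READING (R) and the [dict] PUSH of END-I made kernel AT LEVEL 0:
# ONE background-mediated small-field slot, the two-term family `{small, large}` of ONE decomposition of unity
# `1 = χ_θ(u) + (1 − χ_θ(u))` inside a positive integral, and END-I's per-run binders
# `sh_nonneg ∕ sh_le ∕ cover ∕ piece_le ∕ total_ge` PROVED for it (`M := 1`)
# (cell `pub-balaban`, sub-cell `t4`, spine estimate NE7c (node U5b); NE7c ROUND-2 crew `t4-ne7c-formalise-*`, row S12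
# of the claim table `t4/b2b-balaban-t4-ne7c-p1/LEAVES-NE7c-P1.md` (owner t4-ne7c-p1-g26, TABLE UPDATE l.5714), unit
# `b2b-balaban-t4-ne7c-formalise-leaf-06`; ADDITIVE — imports END-I `ShellMeasureRootComposition` (p207618) and road P2's
# liaison `ShellMeasureWindowLiaison` (p207645) and modifies nothing; 0 `def … : Prop`, 0 sorry, 0 cite tags)

HONEST FRAMING.  Finite four-torus programme, rung (B)+1 only — NOT infinite volume, NOT a mass gap, NOT the Clay
problem, NOT summit progress.  NE7c = `T4IndicatorShell.ShellWeightBound` is NOT PRINTED in [Balaban 1983–89] and NOT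
PROVED; END-I (`ShellMeasureRootComposition.shellWeightBound_of_slotAC`) is the COMPOSITION «NE7c ⇐ the named binders»
(trigger `t4/T4-NE7c-TRIGGER.json` c3).  This file is an INSTANTIABILITY CHECK of END-I's PER-RUN binder shapes on the
cell's own level-0 objects: it shows that the READING (R) of one term family and its [dict] PUSH to a realized measure
are jointly inhabited — with `M := 1` and WITH EQUALITY in `cover` and `total_ge` — by the simplest honest instance, and
that they plug into `ShellMeasureRootComposition.levelLedger_of_slotAC` leaving EXACTLY the wall (M1)₀ =
`T4ShellMeasure.SlotAntiConcentration` at level 0 as the one displayed estimate (supplied for `SU(2)` by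
`ShellMeasureWilsonRealizedSU2.slotAntiConcentration_wilson_su2` p206694 ∕ `ShellMeasureWilsonGaugeInvariant…` p207446 —
NOT by this file).  No (M1), no window (W1), no rate, no count is proved or used here; nothing printed is asserted;
every declaration is [folklore] measure-theoretic bookkeeping.  HONEST DEPENDENCY (cell): continuum YM on T⁴ ⇐ BetaPertH
∧ nine spine estimates (0/9 proved); BetaPertH ⇐ (D1) ∧ (D4) ∧ CAP+tail; G-an2-4 gates asym, D1 and NE2/3/4.

THE INSTANCE (run X ∈ {A, B} of the two-run comparison; the file is written for run A, run B is the same three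
theorems with the roles of the tested variables exchanged).  At cutoff `K` and source `t` the run's level-0 expansion
is a POSITIVE INTEGRAL — a finite measure `μ K t` on the run's level-0 configuration space `Ω K` (the Gibbs factor and
every other nonnegative factor of the term absorbed into the measure; §4 spells the `R·dν` form) — split by ONE
small-field slot, the characteristic function `χ_θ(u) = 1[u < θ]` of ONE cube's tested background variable
`u = u^A K t : Ω K → ℝ` (B14 (2.17) TYPE: `sup_{p ⊂ □∼} |U_{0,□}(V)(∂p) − 1|`, threshold `θ = θ₀`), into the two terms of
the decomposition of unity `1 = χ_θ(u) + ζ_θ(u)` (B15 p. 193 TYPE *"unity 1 = χ + (1 − χ)"*; `T4IndicatorShell.smallInd ∕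
largeInd`): `A K t small = ∫ χ_θ(u^A) dμ`, `A K t large = ∫ ζ_θ(u^A) dμ` (`termWeight`, terms indexed by `Bool`,
`true` = small — the convention of road P2's two-point model `ShellCountSharpWitness`).  Against the other run's tested
variable `u^B K t` on the same space (the common driving field), DESIGN (i) of `T4IndicatorShell` refines the small
term into its CORE `∫ χ_θ(u^A)χ_θ(u^B) dμ` (the IDENTICAL indicator product in both runs, `core_small_eq`) and its SHELL
PART `sh K t small = ∫ χ_θ(u^A)(1 − χ_θ(u^B)) dμ` (= the integral of `T4IndicatorShell.shellPiece` of the one-slot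
product, `shellPart_true_eq_integral_shellPiece`); the LARGE-field term is left whole, `sh K t large = 0`: its
mismatch `ζ_θ(u^A)(1 − ζ_θ(u^B)) = χ_θ(u^B)(1 − χ_θ(u^A))` IS the other run's small-term mismatch and is booked in THAT
run's ledger by the same theorems, while in this run the large-field term sits in NE7b's bad class, whose cores need
no pairing (`T4IndicatorShell.good_ref` constrains the GOOD cores only).  ONE slot `S K = {⋆}` at level `lvl K ⋆ = 0`
with pieces `piece K t ⋆ τ = sh K t τ`; the REALIZED measure of the slot «with the slot's own indicator removed» is
`μ K t` itself, its tested variable `u^A K t`; `M K t ⋆ = 1`.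

## What is proved (all [folklore])

* §1 objects and pointwise facts: `termInd` (`χ` ∕ `ζ` by term), `termWeight`, `shellPart`; measurability and
  integrability of the indicator factors along a measurable tested variable on a finite measure; `sum_termWeight_eq`
  (the partition of unity integrates to the total mass: `Σ_τ A_τ = μ(univ)`), `shellPart_true_eq_integral_shellPiece`,
  `core_small_eq` (`A_small − sh_small = ∫ χ_θ(u^A)χ_θ(u^B) dμ`), `sum_shellPart_le` (under `ρθ`-closeness of the two
  tested variables `μ`-a.e.: `Σ_τ sh_τ ≤ μ{θ(1 − ρ) ≤ u^A < θ}` — road P2's `ShellMeasureWindowLiaison.integral_mismatch_le`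
  with remaining factor `1`).
* §2 END-I's PER-RUN BINDERS for the `(K, t)`-indexed family, in the LITERAL shapes of
  `ShellMeasureRootComposition.levelLedger_of_slotAC` (`T K = univ`, `S K = {()}`, `lvl = 0`, `M = 1`): `sh_nonneg`,
  `sh_le`, `cover` (equality), `M_nonneg`, `piece_le` (needs only `Measurable (u^A K t)` and the a.e. closeness
  `|u^A − u^B| ≤ ρ₀θ₀`), `total_ge` (equality).
* §3 THE PLUG `levelLedger_levelZero`: the six binders + signs `0 ≤ D, ρ` + THE WALL
  `hac : ∀ K t, |t| ≤ l₀ → SlotAntiConcentration (μ K t) (u^A K t) (θ 0) (ρ 0) (D 0)` ⇒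
  `T4ShellMeasureLevels.LevelLedger l₀ T A sh S piece lvl D ρ` for this family, by `levelLedger_of_slotAC` — the only
  estimate left displayed is (M1)₀; `omega_levelZero` (the booked relative shell weight is the one summand `D₀ρ₀`);
  `levelLedger_levelZero_pair` (both runs' ledgers, the symmetric booking).
* §4 the `R·dν` spelling: for `μ = ν.withDensity (ofReal ∘ R)`, `R ≥ 0` measurable, `termWeight` and `shellPart` are the
  positive integrals `∫ ind_τ(u) R dν`, `∫ χ(u^A)(1 − χ(u^B)) R dν`, and `μ` is finite when `R` is `ν`-integrable.

WHAT THIS DOES NOT DO.  It does not supply (M1)₀ (rows S1∕S2 and `ShellMeasureWilson*` do, for `SU(2)`), nor the window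
(W1)∕count (S9, road P2), nor a rate (node U1b), nor any live level `j ≥ 1` (END-II, S7b∕S4∕S11); with ONE level-0 slot at
every `K` the family is NOT in a `LiveWindow` for `K > N₁` — END-I's two-run conclusion is not claimed from level-0 data.
The booking «large-field term whole, shell 0» presupposes that term is in NE7b's bad class (`RelWeightBound`'s `Bad K t`);
that membership is NE7b's datum, not proved here.  NE7c NOT proved; 0/9 spine.
-/

noncomputable section

open MeasureTheory Finset Filter

namespace Summit.QuantumFields.BalabanUV.T4Continuum.ShellMeasureRootCompositionPush

open Literature.MathematicalPhysics.QuantumFieldTheory.Balaban1983to89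
open T4IndicatorShell (smallInd largeInd shellPiece smallInd_nonneg smallInd_le_one largeInd_nonneg largeInd_le_one
  smallInd_add_largeInd)
open T4ShellMeasure (SlotAntiConcentration)
open T4ShellMeasureLevels (LevelLedger)
open ShellMeasureWindowLiaison (integral_mismatch_le mismatch_nonneg mismatch_le_one)
open ShellMeasureRootComposition (levelLedger_of_slotAC)

/-! ## §1 One slot at level 0: the two terms, their weights, their shell parts -/

section Objects

variable {Ω : Type*} [MeasurableSpace Ω]

/-- THE INDICATOR FACTOR CARRIED BY TERM `τ` of the decomposition of unity `1 = χ_θ(u) + ζ_θ(u)` of one small-field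
slot: `τ = true` ↦ the small-field function `χ_θ(u) = 1[u < θ]`, `τ = false` ↦ the large-field function
`ζ_θ(u) = 1[θ ≤ u]` (`T4IndicatorShell.smallInd ∕ largeInd`; the `Bool` convention of road P2's
`ShellCountSharpWitness.ind`). [folklore] -/
def termInd : Bool → ℝ → ℝ → ℝ
  | true, u, θ => smallInd u θ
  | false, u, θ => largeInd u θ

/-- the small term carries `χ_θ`. [folklore] -/
@[simp] theorem termInd_true (u θ : ℝ) : termInd true u θ = smallInd u θ := rfl

/-- the large term carries `ζ_θ`. [folklore] -/
@[simp] theorem termInd_false (u θ : ℝ) : termInd false u θ = largeInd u θ := rfl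

/-- indicator factors are nonnegative. [folklore] -/
theorem termInd_nonneg (τ : Bool) (u θ : ℝ) : 0 ≤ termInd τ u θ := by
  cases τ
  · exact largeInd_nonneg u θ
  · exact smallInd_nonneg u θ

/-- indicator factors are at most `1`. [folklore] -/
theorem termInd_le_one (τ : Bool) (u θ : ℝ) : termInd τ u θ ≤ 1 := by
  cases τ
  · exact largeInd_le_one u θ
  · exact smallInd_le_one u θ

/-- THE DECOMPOSITION OF UNITY of the slot: `χ_θ(u) + ζ_θ(u) = 1` (`T4IndicatorShell.smallInd_add_largeInd`).
[folklore] -/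
theorem termInd_true_add_false (u θ : ℝ) : termInd true u θ + termInd false u θ = 1 :=
  smallInd_add_largeInd u θ

/-- `χ_θ ∘ u` is measurable for a measurable tested variable `u`. [folklore] -/
theorem measurable_smallInd {u : Ω → ℝ} (hu : Measurable u) (θ : ℝ) : Measurable fun ω => smallInd (u ω) θ := by
  unfold T4IndicatorShell.smallInd
  exact Measurable.ite (measurableSet_lt hu measurable_const) measurable_const measurable_const

/-- `ζ_θ ∘ u` is measurable for a measurable tested variable `u`. [folklore] -/
theorem measurable_largeInd {u : Ω → ℝ} (hu : Measurable u) (θ : ℝ) : Measurable fun ω => largeInd (u ω) θ := by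
  unfold T4IndicatorShell.largeInd
  exact Measurable.ite (measurableSet_le measurable_const hu) measurable_const measurable_const

/-- the indicator factor of either term is measurable along a measurable tested variable. [folklore] -/
theorem measurable_termInd (τ : Bool) {u : Ω → ℝ} (hu : Measurable u) (θ : ℝ) :
    Measurable fun ω => termInd τ (u ω) θ := by
  cases τ
  · exact measurable_largeInd hu θ
  · exact measurable_smallInd hu θ

/-- … and integrable against a finite measure (it is measurable and bounded by `1`). [folklore] -/
theorem integrable_termInd (μ : Measure Ω) [IsFiniteMeasure μ] (τ : Bool) {u : Ω → ℝ} (hu : Measurable u) (θ : ℝ) :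
    Integrable (fun ω => termInd τ (u ω) θ) μ :=
  Integrable.mono' (integrable_const (1 : ℝ)) (measurable_termInd τ hu θ).aestronglyMeasurable
    (Eventually.of_forall fun ω => by
      rw [Real.norm_eq_abs, abs_of_nonneg (termInd_nonneg _ _ _)]
      exact termInd_le_one _ _ _)

/-- `χ_θ ∘ u` is integrable against a finite measure. [folklore] -/
theorem integrable_smallInd (μ : Measure Ω) [IsFiniteMeasure μ] {u : Ω → ℝ} (hu : Measurable u) (θ : ℝ) :
    Integrable (fun ω => smallInd (u ω) θ) μ :=
  integrable_termInd μ true hu θ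

/-- THE WEIGHT OF TERM `τ` inside the positive integral `μ`: `A_τ = ∫ ind_τ(u(ω), θ) dμ(ω)` — for the small term
`∫ χ_θ(u) dμ`, for the large term `∫ ζ_θ(u) dμ`. [folklore] -/
def termWeight (μ : Measure Ω) (u : Ω → ℝ) (θ : ℝ) (τ : Bool) : ℝ := ∫ ω, termInd τ (u ω) θ ∂μ

/-- THE SHELL PART OF TERM `τ` AS BOOKED IN THIS RUN'S LEDGER (design (i) of `T4IndicatorShell`): the small term's
mismatch integral `∫ χ_θ(u^A)(1 − χ_θ(u^B)) dμ` against the other run's tested variable `u^B`; the large-field term is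
left whole (shell part `0`: its mismatch `ζ_θ(u^A)(1 − ζ_θ(u^B)) = χ_θ(u^B)(1 − χ_θ(u^A))` is the other run's small-term
mismatch, booked in that run's ledger; here the large-field term belongs to NE7b's bad class). [folklore] -/
def shellPart (μ : Measure Ω) (uA uB : Ω → ℝ) (θ : ℝ) : Bool → ℝ
  | true => ∫ ω, smallInd (uA ω) θ * (1 - smallInd (uB ω) θ) ∂μ
  | false => 0

/-- the small term's shell part is the mismatch integral. [folklore] -/
@[simp] theorem shellPart_true (μ : Measure Ω) (uA uB : Ω → ℝ) (θ : ℝ) :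
    shellPart μ uA uB θ true = ∫ ω, smallInd (uA ω) θ * (1 - smallInd (uB ω) θ) ∂μ := rfl

/-- the large term's shell part is `0`. [folklore] -/
@[simp] theorem shellPart_false (μ : Measure Ω) (uA uB : Ω → ℝ) (θ : ℝ) : shellPart μ uA uB θ false = 0 := rfl

/-- **THE SMALL TERM'S SHELL PART IS DESIGN (i)'s SHELL PIECE, INTEGRATED**: `sh_small = ∫ shellPiece χ^A χ^B 1 0 dμ`
for the one-slot indicator products `χ^X = (χ_θ(u^X(ω)))` (with ONE slot the telescoped shell piece of
`T4IndicatorShell` §2 is the mismatch factor `p 0 · (1 − q 0)` — road P2's `ShellCountSharpWitness.shellPiece_one`,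
re-derived inline by `simp`). [folklore] -/
theorem shellPart_true_eq_integral_shellPiece (μ : Measure Ω) (uA uB : Ω → ℝ) (θ : ℝ) :
    shellPart μ uA uB θ true =
      ∫ ω, shellPiece (fun _ => smallInd (uA ω) θ) (fun _ => smallInd (uB ω) θ) 1 0 ∂μ := by
  simp [shellPiece]

/-- term weights are nonnegative. [folklore] -/
theorem termWeight_nonneg (μ : Measure Ω) (u : Ω → ℝ) (θ : ℝ) (τ : Bool) : 0 ≤ termWeight μ u θ τ :=
  integral_nonneg fun ω => termInd_nonneg τ (u ω) θ

/-- shell parts are nonnegative. [folklore] -/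
theorem shellPart_nonneg (μ : Measure Ω) (uA uB : Ω → ℝ) (θ : ℝ) (τ : Bool) : 0 ≤ shellPart μ uA uB θ τ := by
  cases τ
  · exact le_rfl
  · exact integral_nonneg fun ω => mismatch_nonneg (uA ω) (uB ω) θ

/-- **THE SHELL PART OF A TERM NEVER EXCEEDS THE TERM** (`χ^A(1 − χ^B) ≤ χ^A` pointwise; the large term: `0 ≤ ∫ ζ`).
[folklore] -/
theorem shellPart_le_termWeight (μ : Measure Ω) [IsFiniteMeasure μ] {uA : Ω → ℝ} (huA : Measurable uA)
    (uB : Ω → ℝ) (θ : ℝ) (τ : Bool) : shellPart μ uA uB θ τ ≤ termWeight μ uA θ τ := by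
  cases τ
  · exact termWeight_nonneg μ uA θ false
  · rw [shellPart_true, termWeight]
    refine integral_mono_of_nonneg (Eventually.of_forall fun ω => mismatch_nonneg (uA ω) (uB ω) θ)
      (integrable_termInd μ true huA θ) (Eventually.of_forall fun ω => ?_)
    show smallInd (uA ω) θ * (1 - smallInd (uB ω) θ) ≤ termInd true (uA ω) θ
    rw [termInd_true]
    calc smallInd (uA ω) θ * (1 - smallInd (uB ω) θ) ≤ smallInd (uA ω) θ * 1 :=
          mul_le_mul_of_nonneg_left (sub_le_self _ (smallInd_nonneg _ _)) (smallInd_nonneg _ _)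
      _ = smallInd (uA ω) θ := mul_one _

/-- **THE PARTITION OF UNITY INTEGRATES TO THE TOTAL MASS**: `A_small + A_large = Σ_τ A_τ = μ(univ)`. [folklore] -/
theorem sum_termWeight_eq (μ : Measure Ω) [IsFiniteMeasure μ] {u : Ω → ℝ} (hu : Measurable u) (θ : ℝ) :
    ∑ τ ∈ (univ : Finset Bool), termWeight μ u θ τ = (μ Set.univ).toReal := by
  rw [Fintype.sum_bool, termWeight, termWeight,
    ← integral_add (integrable_termInd μ true hu θ) (integrable_termInd μ false hu θ)]
  simp only [termInd_true_add_false, integral_const, smul_eq_mul, mul_one, measureReal_def]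

/-- **THE CORE OF THE SMALL TERM IS THE COMMON REFINEMENT**: `A_small − sh_small = ∫ χ_θ(u^A)·χ_θ(u^B) dμ` — the
IDENTICAL `{0,1}`-valued indicator product in both runs (the function `T4IndicatorShell.good_ref`'s core sandwich is
about). [folklore] -/
theorem core_small_eq (μ : Measure Ω) [IsFiniteMeasure μ] {uA uB : Ω → ℝ} (huA : Measurable uA) (huB : Measurable uB)
    (θ : ℝ) : termWeight μ uA θ true - shellPart μ uA uB θ true = ∫ ω, smallInd (uA ω) θ * smallInd (uB ω) θ ∂μ := by
  rw [termWeight, shellPart_true, ← integral_sub (integrable_termInd μ true huA θ)]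
  · refine integral_congr_ae (Eventually.of_forall fun ω => ?_)
    simp only [termInd_true]
    ring
  · exact ((integrable_smallInd μ huA θ).mul_of_top_left
      (memLp_top_of_bound ((measurable_smallInd huB θ).const_sub 1).aestronglyMeasurable 1
        (Eventually.of_forall fun ω => by
          rw [Real.norm_eq_abs, abs_le]
          constructor <;> nlinarith [smallInd_nonneg (uB ω) θ, smallInd_le_one (uB ω) θ])))

/-- **THE [dict] PUSH**: under `ρθ`-closeness of the two runs' tested variables `μ`-a.e., the slot's pieces weigh at
most the `μ`-mass of the run's OWN threshold shell: `Σ_τ sh_τ ≤ 1 · μ{θ(1 − ρ) ≤ u^A < θ}` (road P2's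
`ShellMeasureWindowLiaison.integral_mismatch_le` with remaining factor `Rm ≡ 1`, `M = 1`). [folklore] -/
theorem sum_shellPart_le (μ : Measure Ω) [IsFiniteMeasure μ] {uA uB : Ω → ℝ} (huA : Measurable uA) {θ ρ : ℝ}
    (hclose : ∀ᵐ ω ∂μ, |uA ω - uB ω| ≤ ρ * θ) :
    ∑ τ ∈ (univ : Finset Bool), shellPart μ uA uB θ τ ≤
      1 * (μ {ω | θ * (1 - ρ) ≤ uA ω ∧ uA ω < θ}).toReal := by
  rw [Fintype.sum_bool, shellPart_false, add_zero, shellPart_true]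
  have h := integral_mismatch_le μ huA (Rm := fun _ => (1 : ℝ)) (M := 1) hclose
    (Eventually.of_forall fun _ => zero_le_one) (Eventually.of_forall fun _ => le_rfl)
  simpa only [mul_one] using h

end Objects

/-! ## §2 END-I's per-run binders, LITERALLY, for the `(K, t)`-indexed level-0 family -/

section Binders

variable {Ω : ℕ → Type*} [∀ K, MeasurableSpace (Ω K)] (μ : ∀ K : ℕ, ℝ → Measure (Ω K))
  [∀ K t, IsFiniteMeasure (μ K t)] (uA uB : ∀ K : ℕ, ℝ → Ω K → ℝ) (θ ρ : ℕ → ℝ) (l₀ : ℝ)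

omit [∀ K t, IsFiniteMeasure (μ K t)] in
/-- (R) `sh_nonneg` in END-I's shape: shell parts are nonnegative. [folklore] -/
theorem sh_nonneg : ∀ K t, |t| ≤ l₀ → ∀ τ ∈ (univ : Finset Bool),
    0 ≤ shellPart (μ K t) (uA K t) (uB K t) (θ 0) τ :=
  fun K t _ τ _ => shellPart_nonneg (μ K t) (uA K t) (uB K t) (θ 0) τ

/-- (R) `sh_le` in END-I's shape: the shell part of a term never exceeds the term. [folklore] -/
theorem sh_le (huA : ∀ K t, Measurable (uA K t)) : ∀ K t, |t| ≤ l₀ → ∀ τ ∈ (univ : Finset Bool),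
    shellPart (μ K t) (uA K t) (uB K t) (θ 0) τ ≤ termWeight (μ K t) (uA K t) (θ 0) τ :=
  fun K t _ τ _ => shellPart_le_termWeight (μ K t) (huA K t) (uB K t) (θ 0) τ

omit [∀ K t, IsFiniteMeasure (μ K t)] in
/-- (R) `cover` in END-I's shape, WITH EQUALITY: ONE slot, whose piece of term `τ` is the term's shell part.
[folklore] -/
theorem cover : ∀ K t, |t| ≤ l₀ → ∀ τ ∈ (univ : Finset Bool),
    shellPart (μ K t) (uA K t) (uB K t) (θ 0) τ ≤
      ∑ _s ∈ ({()} : Finset Unit), shellPart (μ K t) (uA K t) (uB K t) (θ 0) τ :=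
  fun K t _ τ _ => by rw [Finset.sum_singleton]

/-- [dict] `hM` in END-I's shape: the proportionality constant `M := 1` is nonnegative. [folklore] -/
theorem M_nonneg : ∀ (K : ℕ) (t : ℝ), |t| ≤ l₀ → ∀ _s ∈ ({()} : Finset Unit), (0 : ℝ) ≤ 1 :=
  fun _ _ _ _ _ => zero_le_one

/-- **[dict] PUSH `piece_le` in END-I's shape**: under `ρ₀θ₀`-closeness of the two runs' level-0 tested variables
(`μ K t`-a.e., for `|t| ≤ l₀` — the node-U1b∕NE3-type input in its a.e. form), the slot's pieces weigh at most `1 ×` the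
realized mass of the run's OWN threshold shell `{θ₀(1 − ρ₀) ≤ u^A < θ₀}`. [folklore] -/
theorem piece_le (huA : ∀ K t, Measurable (uA K t))
    (hclose : ∀ K t, |t| ≤ l₀ → ∀ᵐ ω ∂(μ K t), |uA K t ω - uB K t ω| ≤ ρ 0 * θ 0) :
    ∀ K t, |t| ≤ l₀ → ∀ _s ∈ ({()} : Finset Unit),
      ∑ τ ∈ (univ : Finset Bool), shellPart (μ K t) (uA K t) (uB K t) (θ 0) τ ≤
        1 * ((μ K t) {x | θ 0 * (1 - ρ 0) ≤ uA K t x ∧ uA K t x < θ 0}).toReal :=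
  fun K t ht _ _ => sum_shellPart_le (μ K t) (huA K t) (hclose K t ht)

/-- **[dict] PUSH `total_ge` in END-I's shape, WITH EQUALITY**: `1 × μ(univ) = Σ_τ A_τ` (the partition of unity).
[folklore] -/
theorem total_ge (huA : ∀ K t, Measurable (uA K t)) : ∀ K t, |t| ≤ l₀ → ∀ _s ∈ ({()} : Finset Unit),
    1 * ((μ K t) Set.univ).toReal ≤ ∑ τ ∈ (univ : Finset Bool), termWeight (μ K t) (uA K t) (θ 0) τ :=
  fun K t _ _ _ => by rw [one_mul, sum_termWeight_eq (μ K t) (huA K t) (θ 0)]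

end Binders

/-! ## §3 The plug into END-I's one-run ledger: only (M1)₀ stays displayed -/

section Plug

variable {Ω : ℕ → Type*} [∀ K, MeasurableSpace (Ω K)] {μ : ∀ K : ℕ, ℝ → Measure (Ω K)}
  [∀ K t, IsFiniteMeasure (μ K t)] {uA uB : ∀ K : ℕ, ℝ → Ω K → ℝ} {θ ρ D : ℕ → ℝ} {l₀ : ℝ}

/-- **LEVEL 0, ONE SLOT: `LevelLedger` ⇐ (M1)₀.**  For the level-0 two-term family of §2 — terms
`A K t τ = ∫ ind_τ(u^A K t) d(μ K t)`, shell parts `sh K t τ` (small: the mismatch integral against `u^B K t`; large: `0`),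
ONE slot `{()}` at level `0` with `piece = sh`, realized measures `μ K t`, tested variables `u^A K t`, `M = 1` — the six
per-run binders of `ShellMeasureRootComposition.levelLedger_of_slotAC` are THEOREMS (§2), so that
`T4ShellMeasureLevels.LevelLedger l₀ T A sh S piece lvl D ρ` follows from: measurability of `u^A`, the a.e. closeness
`|u^A − u^B| ≤ ρ₀θ₀`, signs `0 ≤ D, ρ`, and THE WALL (M1)₀ `hac : SlotAntiConcentration (μ K t) (u^A K t) (θ 0) (ρ 0) (D 0)`
for `|t| ≤ l₀` — the one displayed estimate (`ShellMeasureWilsonRealizedSU2.slotAntiConcentration_wilson_su2` ∕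
`ShellMeasureWilsonGaugeInvariant.slotAntiConcentration_wilson_su2_gaugeInvariant` supply it for `SU(2)`).  Run B's
ledger: the same with `u^A ↔ u^B` and run B's measures.  CONDITIONAL on `hac`; nothing printed asserted. [folklore] -/
theorem levelLedger_levelZero (huA : ∀ K t, Measurable (uA K t))
    (hclose : ∀ K t, |t| ≤ l₀ → ∀ᵐ ω ∂(μ K t), |uA K t ω - uB K t ω| ≤ ρ 0 * θ 0)
    (hD : ∀ j, 0 ≤ D j) (hρ : ∀ j, 0 ≤ ρ j)
    (hac : ∀ K t, |t| ≤ l₀ → SlotAntiConcentration (μ K t) (uA K t) (θ 0) (ρ 0) (D 0)) :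
    LevelLedger l₀ (fun _ => (univ : Finset Bool)) (fun K t => termWeight (μ K t) (uA K t) (θ 0))
      (fun K t => shellPart (μ K t) (uA K t) (uB K t) (θ 0)) (fun _ => ({()} : Finset Unit))
      (fun K t _ => shellPart (μ K t) (uA K t) (uB K t) (θ 0)) (fun _ _ => 0) D ρ :=
  levelLedger_of_slotAC (Ω := fun K _ => Ω K) (μ := fun K t _ => μ K t) (u := fun K t _ => uA K t) (θ := θ)
    (M := fun _ _ _ => (1 : ℝ))
    (sh_nonneg μ uA uB θ l₀) (sh_le μ uA uB θ l₀ huA) (cover μ uA uB θ l₀) (M_nonneg l₀)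
    (piece_le μ uA uB θ ρ l₀ huA hclose) (total_ge μ uA θ l₀ huA) hD hρ (fun K t ht _ _ => hac K t ht)

/-- the relative shell weight this ledger books at cutoff `K` is ONE level-0 summand `D₀ρ₀`
(`T4ShellMeasureLevels.LevelLedger.omega_eq`). [folklore] -/
theorem omega_levelZero (huA : ∀ K t, Measurable (uA K t))
    (hclose : ∀ K t, |t| ≤ l₀ → ∀ᵐ ω ∂(μ K t), |uA K t ω - uB K t ω| ≤ ρ 0 * θ 0)
    (hD : ∀ j, 0 ≤ D j) (hρ : ∀ j, 0 ≤ ρ j)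
    (hac : ∀ K t, |t| ≤ l₀ → SlotAntiConcentration (μ K t) (uA K t) (θ 0) (ρ 0) (D 0)) (K : ℕ) :
    (levelLedger_levelZero huA hclose hD hρ hac).toSlotLedger.omega K = D 0 * ρ 0 :=
  (T4ShellMeasureLevels.LevelLedger.omega_eq (levelLedger_levelZero huA hclose hD hρ hac) K).trans
    (Finset.sum_singleton _ _)

/-- **BOTH RUNS' LEVEL-0 LEDGERS AT ONCE** (the symmetric booking): run A books `∫ χ_θ(u^A)(1 − χ_θ(u^B)) dμ^A`, run B
books `∫ χ_θ(u^B)(1 − χ_θ(u^A)) dμ^B` — together the whole unpaired mass `|χ_θ(u^A) − χ_θ(u^B)|` of the slot — each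
against its OWN threshold shell, with its own (M1)₀ and its own constants `D^A`, `D^B` (synchronised threshold `θ₀` and
relative width `ρ₀`, node U5a); the closeness is asked a.e. for each run's measure. [folklore] -/
theorem levelLedger_levelZero_pair {μA μB : ∀ K : ℕ, ℝ → Measure (Ω K)} [∀ K t, IsFiniteMeasure (μA K t)]
    [∀ K t, IsFiniteMeasure (μB K t)] {DA DB : ℕ → ℝ}
    (huA : ∀ K t, Measurable (uA K t)) (huB : ∀ K t, Measurable (uB K t))
    (hcloseA : ∀ K t, |t| ≤ l₀ → ∀ᵐ ω ∂(μA K t), |uA K t ω - uB K t ω| ≤ ρ 0 * θ 0)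
    (hcloseB : ∀ K t, |t| ≤ l₀ → ∀ᵐ ω ∂(μB K t), |uB K t ω - uA K t ω| ≤ ρ 0 * θ 0)
    (hDA : ∀ j, 0 ≤ DA j) (hDB : ∀ j, 0 ≤ DB j) (hρ : ∀ j, 0 ≤ ρ j)
    (hacA : ∀ K t, |t| ≤ l₀ → SlotAntiConcentration (μA K t) (uA K t) (θ 0) (ρ 0) (DA 0))
    (hacB : ∀ K t, |t| ≤ l₀ → SlotAntiConcentration (μB K t) (uB K t) (θ 0) (ρ 0) (DB 0)) :
    LevelLedger l₀ (fun _ => (univ : Finset Bool)) (fun K t => termWeight (μA K t) (uA K t) (θ 0))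
        (fun K t => shellPart (μA K t) (uA K t) (uB K t) (θ 0)) (fun _ => ({()} : Finset Unit))
        (fun K t _ => shellPart (μA K t) (uA K t) (uB K t) (θ 0)) (fun _ _ => 0) DA ρ ∧
      LevelLedger l₀ (fun _ => (univ : Finset Bool)) (fun K t => termWeight (μB K t) (uB K t) (θ 0))
        (fun K t => shellPart (μB K t) (uB K t) (uA K t) (θ 0)) (fun _ => ({()} : Finset Unit))
        (fun K t _ => shellPart (μB K t) (uB K t) (uA K t) (θ 0)) (fun _ _ => 0) DB ρ :=
  ⟨levelLedger_levelZero huA hcloseA hDA hρ hacA, levelLedger_levelZero huB hcloseB hDB hρ hacB⟩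

end Plug

/-! ## §4 The `R·dν` spelling of the positive integral -/

section Density

variable {Ω : Type*} [MeasurableSpace Ω]

/-- «INSIDE A POSITIVE INTEGRAL»: if the run's level-0 expansion is `∫ (·) R dν` with a measurable nonnegative factor
`R` (the Gibbs factor and every other nonnegative factor of the term), the finite measure of §1–§3 is
`μ = ν.withDensity (ofReal ∘ R)` and the term weights are the positive integrals `A_τ = ∫ ind_τ(u) · R dν`. [folklore] -/
theorem termWeight_withDensity (ν : Measure Ω) {R : Ω → ℝ} (hR : Measurable R) (hR0 : ∀ ω, 0 ≤ R ω) (u : Ω → ℝ)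
    (θ : ℝ) (τ : Bool) :
    termWeight (ν.withDensity fun ω => ENNReal.ofReal (R ω)) u θ τ = ∫ ω, termInd τ (u ω) θ * R ω ∂ν := by
  rw [termWeight, integral_withDensity_eq_integral_toReal_smul hR.ennreal_ofReal
    (Eventually.of_forall fun _ => ENNReal.ofReal_lt_top)]
  refine integral_congr_ae (Eventually.of_forall fun ω => ?_)
  simp only [ENNReal.toReal_ofReal (hR0 ω), smul_eq_mul, mul_comm]

/-- … and the small term's shell part is `∫ χ_θ(u^A)(1 − χ_θ(u^B)) · R dν`. [folklore] -/
theorem shellPart_true_withDensity (ν : Measure Ω) {R : Ω → ℝ} (hR : Measurable R) (hR0 : ∀ ω, 0 ≤ R ω)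
    (uA uB : Ω → ℝ) (θ : ℝ) :
    shellPart (ν.withDensity fun ω => ENNReal.ofReal (R ω)) uA uB θ true =
      ∫ ω, smallInd (uA ω) θ * (1 - smallInd (uB ω) θ) * R ω ∂ν := by
  rw [shellPart_true, integral_withDensity_eq_integral_toReal_smul hR.ennreal_ofReal
    (Eventually.of_forall fun _ => ENNReal.ofReal_lt_top)]
  refine integral_congr_ae (Eventually.of_forall fun ω => ?_)
  simp only [ENNReal.toReal_ofReal (hR0 ω), smul_eq_mul]
  ring

/-- … and `μ` is a finite measure as soon as `R` is `ν`-integrable (Mathlib `isFiniteMeasure_withDensity_ofReal`), so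
that §2–§3 apply with `μ K t := (ν K t).withDensity (ofReal ∘ R K t)`. [folklore] -/
theorem isFiniteMeasure_withDensity (ν : Measure Ω) {R : Ω → ℝ} (hR : Integrable R ν) :
    IsFiniteMeasure (ν.withDensity fun ω => ENNReal.ofReal (R ω)) :=
  isFiniteMeasure_withDensity_ofReal hR.2

end Density

end Summit.QuantumFields.BalabanUV.T4Continuum.ShellMeasureRootCompositionPush

end
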